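import Summits.ResolutionOfSingularities.ResolutionOfSingularities.Theorems.SyzygyFlatteningGlobalisationCentreChart
import Literature.AlgebraicGeometry.Resolution.ZariskiFiniteness
import Literature.AlgebraicGeometry.Resolution.FieldsJ2
import HarnessLib

/-!
# The regular-centre locus of a proper model is open in `Zar(K/k)` — `stub_regCentreOpen`

Crux `SyzygyFlattening.Globalisation` (stmt-ResolutionOfSingularities-17061), line `birth`,
registered stub `stub_regCentreOpen`: for a proper model `M` of `K/k` (`ProperModel k K`,
`Literature/…/ProperModels.lean`) the set `{v ∈ Zar(K/k) | 𝒪_{M, centre v} is regular}`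
(`ProperModel.RegCentre`) is OPEN in the Zariski–Riemann space — the openness of the loci `U_m`
in the lead's TowerCompactness argument (Zariski–Samuel II, Ch. VI §17, Lemma 1: continuity of
the centre map on an affine representative, composed with the openness of `Reg` of a finitely
generated algebra over a field).

Proof. Fix `v₀` with regular centre `x₀`, an affine open `U ∋ x₀` and the chart
`A = im (Γ(M, U) → K) ⊆ 𝒪_{v₀}` (a finitely generated `k`-subalgebra of `K`; this is the
hypothesis of the stub = `stub_centreChart`, `…GlobalisationCentreChart.lean`). For EVERY
`w ∈ Zar(K/k)` with `A ⊆ 𝒪_w`: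

* `regCentreOpen_specKTo_comp_chartLift` — `Spec 𝒪_w → Spec Γ(M, U) = U ⊆ M` is a lift of the
  `K`-point; `regCentreOpen_lift_comp_π` — any lift of the `K`-point lies over `Spec 𝒪_w → Spec k`,
  so (`regCentreOpen_lift_closedPoint`) its closed point is THE centre of `w`, which therefore
  lies in `U` (`regCentreOpen_centre_mem`);
* `regCentreOpen_regCentre_iff_locAt`, `regCentreOpen_regCentre_iff_atPrime` — hence
  `𝒪_{M, centre w} ≅ locAt 𝒪_w A = A_{𝔪_w ∩ A}` (`centreChart_locAt_toSubring_eq_of_lift`,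
  `centreChart_stalkToK_injective`), and `M.RegCentre w ↔ HasRegularCentre A w`.

So the regular-centre locus contains the open set `{w | HasRegularCentre A w}`
(`ZariskiRiemannSpace.isOpen_setOf_hasRegularCentre`, `Reg A` open by `isJ2Ring_of_field`)
containing `v₀`: `isOpen_setOf_regCentre_of_chart`, and unconditionally `isOpen_setOf_regCentre`.
-/

noncomputable section

-- single-problem summit: the doubled namespace component `ResolutionOfSingularities` is forced
set_option linter.dupNamespace false

namespace Summit.ResolutionOfSingularities.ResolutionOfSingularities.Theorems.SyzygyFlattening

open CategoryTheory AlgebraicGeometry TopologicalSpace IsLocalRing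
open Literature.AlgebraicGeometry.Resolution

universe u

/-! ## Lifts of the `K`-point through `Spec 𝒪_v` -/

section Lift

variable {k K : Type u} [Field k] [Field K] [Algebra k K]

/-- **A lift `Spec 𝒪_v → M` of the `K`-point automatically lies over `Spec 𝒪_v → Spec k`**:
both structure maps `k → 𝒪_v` agree after `𝒪_v ⊆ K`, where they induce `gen_M ≫ π_M`.
[folklore] -/
theorem regCentreOpen_lift_comp_π {M : ProperModel k K} (v : ZariskiRiemannSpace k K)
    (l : Spec (CommRingCat.of v.asValuationSubring) ⟶ M.X) (hl : KModel.specKTo v ≫ l = M.gen) :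
    l ≫ M.π = KModel.specOTo v := by
  -- adapted from `ProjModel.lift_comp_π_eq_specOTo` (ProjectiveModelsCentresLocal.lean)
  obtain ⟨χ, hχ⟩ : ∃ χ, Spec.map χ = l ≫ M.π := ⟨_, Spec.map_preimage _⟩
  rw [← hχ, KModel.specOTo]
  congr 1
  have h1 : χ ≫ CommRingCat.ofHom (algebraMap v.asValuationSubring K) =
      CommRingCat.ofHom (KModel.toValuationSubringHom v) ≫
        CommRingCat.ofHom (algebraMap v.asValuationSubring K) := by
    apply Spec.map_injective
    rw [Spec.map_comp, Spec.map_comp, hχ, ← Category.assoc]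
    change (KModel.specKTo v ≫ l) ≫ M.π = KModel.specKTo v ≫ KModel.specOTo v
    rw [hl, M.gen_π, KModel.specKTo_specOTo]
  haveI : Mono (CommRingCat.ofHom (algebraMap v.asValuationSubring K)) :=
    ConcreteCategory.mono_of_injective _ Subtype.val_injective
  exact (cancel_mono _).mp h1

/-- **The closed point of a lift of the `K`-point is the centre** (uniqueness of the centre on
the separated model `M`). [cite: ZariskiSamuel1960, Ch. VI §17] -/
theorem regCentreOpen_lift_closedPoint {M : ProperModel k K} (v : ZariskiRiemannSpace k K)
    (l : Spec (CommRingCat.of v.asValuationSubring) ⟶ M.X) (hl : KModel.specKTo v ≫ l = M.gen) :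
    l (closedPoint v.asValuationSubring) = M.centre v :=
  ProperModel.eq_centre_of_isCentre ⟨l, hl, regCentreOpen_lift_comp_π v l hl, rfl⟩

/-- **The lift through an affine chart.** If `Γ(M, U) → K` takes values in `𝒪_v` (a ring map
`g : Γ(M, U) → 𝒪_v` compatible with `Γ(M, U) → K(M) ≅ K`), then
`Spec 𝒪_v → Spec Γ(M, U) = U ⊆ M` restricts to the `K`-point on `Spec K`
(`Spec K(M) → Spec Γ(M, U) → M` is `Spec K(M) → M`, `IsAffineOpen.fromSpecStalk`).
[cite: ZariskiSamuel1960, Ch. VI §17] -/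
theorem regCentreOpen_specKTo_comp_chartLift {M : ProperModel k K} {U : M.X.Opens}
    (hU : IsAffineOpen U) (hU' : genericPoint M.X ∈ U) (v : ZariskiRiemannSpace k K)
    (g : Γ(M.X, U) →+* v.asValuationSubring)
    (hg : ∀ f, ((g f : v.asValuationSubring) : K) =
      (M.X.presheaf.germ U (genericPoint M.X) hU' ≫ M.funFieldIso.hom).hom f) :
    KModel.specKTo v ≫ (Spec.map (CommRingCat.ofHom g) ≫ hU.fromSpec) = M.gen := by
  have h1 : CommRingCat.ofHom g ≫ CommRingCat.ofHom (algebraMap v.asValuationSubring K) =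
      M.X.presheaf.germ U (genericPoint M.X) hU' ≫ M.funFieldIso.hom := by
    ext f
    exact hg f
  have h2 : Spec.map (M.X.presheaf.germ U (genericPoint M.X) hU') ≫ hU.fromSpec =
      M.X.fromSpecStalk (genericPoint M.X) := hU.fromSpecStalk_eq_fromSpecStalk hU'
  rw [KModel.specKTo, ← Spec.map_comp_assoc, h1, Spec.map_comp, Category.assoc, h2,
    ProperModel.specMap_funFieldIso_hom_fromSpecStalk]

/-- The lift through an affine chart `U` maps the closed point into `U`. [folklore] -/
theorem regCentreOpen_chartLift_closedPoint_mem {M : ProperModel k K} {U : M.X.Opens}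
    (hU : IsAffineOpen U) (v : ZariskiRiemannSpace k K)
    (g : Γ(M.X, U) →+* v.asValuationSubring) :
    (Spec.map (CommRingCat.ofHom g) ≫ hU.fromSpec) (closedPoint v.asValuationSubring) ∈ U := by
  rw [Scheme.Hom.comp_apply, ← SetLike.mem_coe, ← hU.range_fromSpec]
  exact Set.mem_range_self _

/-- **Continuity of the centre map, pointwise** (Zariski–Samuel II, Ch. VI §17, Lemma 1): if the
image of `Γ(M, U) → K` lies in `𝒪_v` then the centre of `v` on `M` lies in the affine open `U`
(it is the image of `𝔪_v ∩ Γ(M, U)` under `Spec Γ(M, U) = U`).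
[cite: ZariskiSamuel1960, Ch. VI §17, Lemma 1] -/
theorem regCentreOpen_centre_mem (M : ProperModel k K) {U : M.X.Opens} (hU : IsAffineOpen U)
    (hU' : genericPoint M.X ∈ U) (v : ZariskiRiemannSpace k K)
    (hle : (M.X.presheaf.germ U (genericPoint M.X) hU' ≫ M.funFieldIso.hom).hom.range ≤
      v.asValuationSubring.toSubring) :
    M.centre v ∈ U := by
  set sec : Γ(M.X, U) →+* K :=
    (M.X.presheaf.germ U (genericPoint M.X) hU' ≫ M.funFieldIso.hom).hom with hsec
  let g : Γ(M.X, U) →+* v.asValuationSubring :=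
    sec.codRestrict v.asValuationSubring fun f => hle ⟨f, rfl⟩
  rw [← regCentreOpen_lift_closedPoint v _
    (regCentreOpen_specKTo_comp_chartLift hU hU' v g fun _ => rfl)]
  exact regCentreOpen_chartLift_closedPoint_mem hU v g

end Lift

/-! ## The local ring at the centre through a chart, and regularity -/

section Chart

variable {k K : Type} [Field k] [Field K] [Algebra k K]

/-- **The local ring at the centre is the chart localised at the centre.** For an affine open
`U` of a proper model `M`, a `k`-subalgebra `A ⊆ K` whose subring is the image of `Γ(M, U) → K`,
and ANY `w ∈ Zar(K/k)` with `A ⊆ 𝒪_w`: `𝒪_{M, centre w}` is a regular local ring iff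
`locAt 𝒪_w A = A_{𝔪_w ∩ A} ⊆ K` is — the centre of `w` lies in `U` and
`𝒪_{M, centre w} → K` is injective with image `locAt 𝒪_w A`
(`centreChart_locAt_toSubring_eq_of_lift`). [cite: ZariskiSamuel1960, Ch. VI §17] -/
theorem regCentreOpen_regCentre_iff_locAt (M : ProperModel k K) {U : M.X.Opens}
    (hU : IsAffineOpen U) (hU' : genericPoint M.X ∈ U) (A : Subalgebra k K)
    (hA : A.toSubring =
      (M.X.presheaf.germ U (genericPoint M.X) hU' ≫ M.funFieldIso.hom).hom.range)
    (w : ZariskiRiemannSpace k K) (hw : A.toSubring ≤ w.asValuationSubring.toSubring) :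
    M.RegCentre w ↔ IsRegularLocalRing ↥(locAt w.asValuationSubring A) := by
  set sec : Γ(M.X, U) →+* K :=
    (M.X.presheaf.germ U (genericPoint M.X) hU' ≫ M.funFieldIso.hom).hom with hsec
  let g : Γ(M.X, U) →+* w.asValuationSubring :=
    sec.codRestrict w.asValuationSubring fun f => hw (hA.ge ⟨f, rfl⟩)
  set l : Spec (CommRingCat.of w.asValuationSubring) ⟶ M.X :=
    Spec.map (CommRingCat.ofHom g) ≫ hU.fromSpec with hl_def
  have hl : KModel.specKTo w ≫ l = M.gen :=
    regCentreOpen_specKTo_comp_chartLift hU hU' w g fun _ => rfl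
  have hxU : l (closedPoint w.asValuationSubring) ∈ U :=
    regCentreOpen_chartLift_closedPoint_mem hU w g
  have hcx : l (closedPoint w.asValuationSubring) = M.centre w :=
    regCentreOpen_lift_closedPoint w l hl
  -- `(locAt 𝒪_w A) = im (𝒪_{M,x} → K)`, `x` the closed point of the lift, and `𝒪_{M,x} → K` injective
  have hloc := centreChart_locAt_toSubring_eq_of_lift w l hl hU hxU rfl A hA
  set toK := (M.X.presheaf.stalkSpecializes
    (genericPoint_specializes (l (closedPoint w.asValuationSubring))) ≫ M.funFieldIso.hom).hom
    with htoK
  have hinj : Function.Injective toK := centreChart_stalkToK_injective M _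
  let e := (RingEquiv.ofBijective toK.rangeRestrict
    ⟨fun a b h => hinj (congrArg Subtype.val h), RingHom.rangeRestrict_surjective toK⟩).trans
      (RingEquiv.subringCongr hloc.symm)
  change IsRegularLocalRing (M.X.presheaf.stalk (M.centre w)) ↔ _
  rw [← hcx]
  exact ⟨fun _ => .of_ringEquiv e, fun _ => .of_ringEquiv e.symm⟩

/-- The same with the abstract local ring: **`M.RegCentre w ↔ A_{𝔪_w ∩ A}` is regular**
(`Localization.AtPrime` of the centre `𝔪_w ∩ A`, the form of `HasRegularCentre`).
[cite: ZariskiSamuel1960, Ch. VI §17] -/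
theorem regCentreOpen_regCentre_iff_atPrime (M : ProperModel k K) {U : M.X.Opens}
    (hU : IsAffineOpen U) (hU' : genericPoint M.X ∈ U) (A : Subalgebra k K)
    (hA : A.toSubring =
      (M.X.presheaf.germ U (genericPoint M.X) hU' ≫ M.funFieldIso.hom).hom.range)
    (w : ZariskiRiemannSpace k K) (hw : A.toSubring ≤ w.asValuationSubring.toSubring) :
    M.RegCentre w ↔
      IsRegularLocalRing (Localization.AtPrime (centre A w.asValuationSubring hw)) := by
  rw [regCentreOpen_regCentre_iff_locAt M hU hU' A hA w hw,
    isRegularLocalRing_locAt_iff_atPrime w.asValuationSubring A hw]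
  rfl

/-- Hence **`M.RegCentre w ↔ HasRegularCentre A w`** for `A ⊆ 𝒪_w` the chart of an affine open.
[cite: ZariskiSamuel1960, Ch. VI §17] -/
theorem regCentreOpen_regCentre_iff_hasRegularCentre (M : ProperModel k K) {U : M.X.Opens}
    (hU : IsAffineOpen U) (hU' : genericPoint M.X ∈ U) (A : Subalgebra k K)
    (hA : A.toSubring =
      (M.X.presheaf.germ U (genericPoint M.X) hU' ≫ M.funFieldIso.hom).hom.range)
    (w : ZariskiRiemannSpace k K) (hw : A.toSubring ≤ w.asValuationSubring.toSubring) :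
    M.RegCentre w ↔ ZariskiRiemannSpace.HasRegularCentre A w := by
  rw [regCentreOpen_regCentre_iff_atPrime M hU hU' A hA w hw]
  exact ⟨fun h => ⟨hw, h⟩, fun ⟨_, h⟩ => h⟩

/-! ## Openness of the regular-centre locus -/

/-- **The regular-centre locus of a proper model is open**, given the chart dictionary at the
centres of `M` (the statement of `stub_centreChart` for `M`): for `v₀` with regular centre
`x₀ ∈ U` affine and `A = im (Γ(M, U) → K)`, the open set `{w | A ⊆ 𝒪_w, A_{𝔪_w ∩ A} regular}`
(`ZariskiRiemannSpace.isOpen_setOf_hasRegularCentre`; `Reg A` is open since `A` is of finite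
type over the field `k`, `isJ2Ring_of_field`) contains `v₀` and consists of valuations with a
regular centre on `M` (`regCentreOpen_regCentre_iff_hasRegularCentre`).
[cite: ZariskiSamuel1960, Ch. VI §17, Lemma 1] -/
theorem isOpen_setOf_regCentre_of_chart (M : ProperModel k K)
    (hchart : ∀ (v : ZariskiRiemannSpace k K) (U : M.X.Opens) (_hU : IsAffineOpen U)
      (hx : M.centre v ∈ U),
      Function.Injective
          ((M.X.presheaf.stalkSpecializes (genericPoint_specializes (M.centre v)) ≫
            M.funFieldIso.hom).hom) ∧
        ∃ A : Subalgebra k K,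
          (A : Set K) = Set.range
            (((M.X.presheaf.stalkSpecializes (genericPoint_specializes (M.centre v)) ≫
                M.funFieldIso.hom).hom).comp (M.X.presheaf.germ U (M.centre v) hx).hom) ∧
          A.FG ∧ IsFractionRing ↥A K ∧ A.toSubring ≤ v.asValuationSubring.toSubring ∧
          (locAt v.asValuationSubring A).toSubring =
            ((M.X.presheaf.stalkSpecializes (genericPoint_specializes (M.centre v)) ≫
              M.funFieldIso.hom).hom).range) :
    IsOpen {v : ZariskiRiemannSpace k K | M.RegCentre v} := by
  rw [isOpen_iff_forall_mem_open]
  intro v₀ hv₀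
  -- an affine chart at the centre of `v₀`
  obtain ⟨U, hU, hxU, -⟩ := exists_isAffineOpen_mem_and_subset (X := M.X) (x := M.centre v₀)
    (U := ⊤) trivial
  obtain ⟨-, A, hAc, hfg, -, hle, -⟩ := hchart v₀ U hU hxU
  have hU' : genericPoint M.X ∈ U := centreChart_genericPoint_mem hxU
  -- the carrier of `A` is the image of `Γ(M, U) → K` (independent of the point)
  have hA : A.toSubring =
      (M.X.presheaf.germ U (genericPoint M.X) hU' ≫ M.funFieldIso.hom).hom.range := by
    refine SetLike.ext' ?_
    rw [Subalgebra.coe_toSubring, hAc, RingHom.coe_range]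
    ext z
    constructor
    · rintro ⟨f, rfl⟩
      exact ⟨f, (centreChart_stalkToK_germ M hxU f).symm⟩
    · rintro ⟨f, rfl⟩
      exact ⟨f, centreChart_stalkToK_germ M hxU f⟩
  have hreg : IsOpen (regularLocus ↥A) :=
    (isJ2Ring_of_field k).2 ↥A ((Subalgebra.fg_iff_finiteType A).mp hfg)
  refine ⟨{w | ZariskiRiemannSpace.HasRegularCentre A w}, fun w hw => ?_,
    ZariskiRiemannSpace.isOpen_setOf_hasRegularCentre hfg hreg, ?_⟩
  · exact (regCentreOpen_regCentre_iff_hasRegularCentre M hU hU' A hA w hw.le).mpr hw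
  · exact (regCentreOpen_regCentre_iff_hasRegularCentre M hU hU' A hA v₀ hle).mp hv₀

/-- **The regular-centre locus `{v ∈ Zar(K/k) | 𝒪_{M, centre v} regular}` of a proper model is
open**, unconditionally (the chart dictionary is `stub_centreChart`).
[cite: ZariskiSamuel1960, Ch. VI §17, Lemma 1] -/
theorem isOpen_setOf_regCentre (M : ProperModel k K) :
    IsOpen {v : ZariskiRiemannSpace k K | M.RegCentre v} :=
  isOpen_setOf_regCentre_of_chart M (stub_centreChart k K M)

end Chart

/-! ## The registered stub -/

/-- **STUB `stub_regCentreOpen`.** The regular-centre locus of a proper model is open in `Zar(K/k)`: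
for `v` with regular centre `x`, pick an affine open `U = Spec A ∋ x`; every `w` with `A ⊆ 𝒪_w` has its
centre in `U`, at the point `𝔪_w ∩ A`, with local ring `A_{𝔪_w ∩ A}`; so the locus contains the open set
`{w : A ⊆ 𝒪_w, A_{𝔪_w ∩ A} regular}` (`ZariskiRiemannSpace.isOpen_setOf_hasRegularCentre`, openness
of `Reg A`: `IsJ2Ring` of a field) containing `v`.
[cite: ZariskiSamuel1960, Ch. VI §17, Lemma 1] -/
theorem stub_regCentreOpen :
    (∀ (k K : Type) [Field k] [Field K] [Algebra k K]
      (M : ProperModel k K) (v : ZariskiRiemannSpace k K) (U : M.X.Opens) (_hU : IsAffineOpen U)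
      (hx : M.centre v ∈ U),
      Function.Injective
          ((M.X.presheaf.stalkSpecializes (genericPoint_specializes (M.centre v)) ≫
            M.funFieldIso.hom).hom) ∧
        ∃ A : Subalgebra k K,
          (A : Set K) = Set.range
            (((M.X.presheaf.stalkSpecializes (genericPoint_specializes (M.centre v)) ≫
                M.funFieldIso.hom).hom).comp (M.X.presheaf.germ U (M.centre v) hx).hom) ∧
          A.FG ∧ IsFractionRing ↥A K ∧ A.toSubring ≤ v.asValuationSubring.toSubring ∧
          (locAt v.asValuationSubring A).toSubring =
            ((M.X.presheaf.stalkSpecializes (genericPoint_specializes (M.centre v)) ≫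
              M.funFieldIso.hom).hom).range) →
    ∀ (k K : Type) [Field k] [Field K]
    [Algebra k K] (M : ProperModel k K), IsOpen {v : ZariskiRiemannSpace k K | M.RegCentre v} := by
  intro hchart k K _ _ _ M
  exact isOpen_setOf_regCentre_of_chart M (hchart k K M)

end Summit.ResolutionOfSingularities.ResolutionOfSingularities.Theorems.SyzygyFlattening

end
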